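/-
Copyright: cell pub-balaban-gaps (YM BLITZ Y1, track G1), seat g1-p2 GEN 7 (unit `pub-balaban-gaps-g1-p2`).  Row (D4) NODE O,
OBJECT level: the TWO WINDOWS of `D4WalkBlockCovariantShift` (bond window `ηα`, divergence window `η²α′` of the transport defects
`W_b = R(U′_b) − 1`, `R(U)X = UXU⁻¹`) DERIVED BY PURE ALGEBRA from print's (3.37)-type letters on the transporters themselves: row ∕
column sums of `U′_b − 1`, `U′_b⁻¹ − 1` at most `δ = O(ηα₁)` (the bond window of (3.37): `|A| < α₁(Lʲη)⁻¹`, `U′ = e^{iηA}`) and of the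
DISCRETE DERIVATIVE `U′_{(x,x+e_μ)} − U′_{(x−e_μ,x)}` at most `δ′ = O(η²α₁)` ((3.37): `|∇A| < α₁(Lʲη)⁻²`): the divergence of the defects
is `ad_{U′_b − U′_{b′}}` to first order («Σ_{b∈st(x)}W_b = iη²ad_{∇*A}») plus SECOND-order terms `O(δ²)` — the fibre algebra behind
(3.51)–(3.54).  With `D4WalkBlockCovariantShift.blockWalkExpansion_covShift_oneScaleTorus` this gives Cor. 3.5's step for the covariant
Laplacian (plus a cube-local averaging correction, `D4WalkBlockCovariantAveraging`) in ANY transporter background with these two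
letters (§4).  HONEST FRAMING: fibre algebra on `Matrix (Fin N) (Fin N) ℂ`; the
transporters are a holomorphic hypothesis family with the two letters (for `U′ = e^{iηA}` they are (3.37) + `‖e^{B} − 1‖ ≤ e^{‖B‖} − 1`,
not typed here); averaging corrections F′₂ not included; (D4) instance 0∕1; NOT BetaPertH, NOT continuum, NOT Clay.
-/
import Summits.QuantumFields.BalabanUV.Gaps.D4WalkBlockCovariantAveraging
import Summits.QuantumFields.BalabanUV.Gaps.D4WalkBlockTransportAlgebra
import Summits.QuantumFields.BalabanUV.Gaps.D4WalkBlockShiftTransport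

/-!
# `Gaps.D4WalkBlockTransportWindows` — the bond and divergence windows of the transport defects from letters on the transporters
# (the fibre algebra of (3.51)–(3.54)), and Cor. 3.5's step in a transporter background (cell pub-balaban-gaps, seat g1-p2 gen 7)

HONEST DEPENDENCY (cell pub-balaban, verbatim): continuum YM on T⁴ ⇐ BetaPertH ∧ nine spine estimates (0/9 proved);
BetaPertH ⇐ (D1) ∧ (D4) ∧ CAP+tail.

* (part 1 `D4WalkBlockTransportAlgebra`: `conjOp`, the bond window `rowMass_defect_le_of_letters`, the divergence identity
  `defect_pair_eq` and window `rowMass_defect_pair_le`.)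
* §4 **`blockWalkExpansion_transport_oneScaleTorus`** — 59b's END for transporter fields `U⁺_μ(u, x)` (bond `(x, x + e_μ)`) with inverses,
  defects `W⁺_μ(x) = conjOp U U⁻ − 1`, `W⁻_μ(x) = conjOp V⁻ V − 1` (`V = U⁺_μ(u, x − e_μ)`), under the letters `δ = ηα₀`, `δ′ = η²α₁` on the
  ball, plus a cube-local averaging correction `V_av` (62): `(G′ ⊗ 1)(1 − (V_W + V_av)(u)(G′ ⊗ 1))⁻¹` is a block walk expansion with
  derivative letters, constants uniform in `K`, the volume, `N`-explicit.
References: T. Bałaban, Comm. Math. Phys. **99** (1985) 389–434 [B9], (3.37) p. 396, (3.50)–(3.54) pp. 400–401, Cor. 3.5 p. 407.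
-/

noncomputable section

namespace Summit.QuantumFields.BalabanUV.Gaps.D4WalkBlockTransportWindows

open Metric Set Finset
open scoped Matrix
open Literature.MathematicalPhysics.QuantumFieldTheory.Balaban1983to89
open Literature.MathematicalPhysics.QuantumFieldTheory.Balaban1983to89.B9SectDWalk (DomBy)
open Literature.MathematicalPhysics.QuantumFieldTheory.Balaban1983to89.B9Thm34Ext (toB6)
open Literature.MathematicalPhysics.QuantumFieldTheory.Balaban1983to89.B9Thm37GlueTorus (torusGeom tdist1)
open Literature.MathematicalPhysics.QuantumFieldTheory.Balaban1983to89.TreeLengthTorus (TPt)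
open Literature.MathematicalPhysics.QuantumFieldTheory.Balaban1983to89.B5TorusCover (UT)
open Literature.MathematicalPhysics.QuantumFieldTheory.Balaban1983to89.B11SectG (RowSum)
open Literature.MathematicalPhysics.QuantumFieldTheory.Balaban1983to89.B5Ineq137Torus (Nv)
open Literature.MathematicalPhysics.QuantumFieldTheory.Balaban1983to89.B6Prop22OneScaleTorus (Index)
open Literature.MathematicalPhysics.QuantumFieldTheory.Balaban1983to89.B1RG242Torus (tower deriv)
open Summit.QuantumFields.BalabanUV.Gaps.D4WalkBlock (blockNorm BlockWalkExpansion)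
open Summit.QuantumFields.BalabanUV.Gaps.D4WalkBlockFlatLetters (cubeOf)
open Summit.QuantumFields.BalabanUV.Gaps.D4WalkBlockCovariantShift (covDop covB covShift)
open Summit.QuantumFields.BalabanUV.Gaps.D4WalkBlockCovariantAveraging (blockWalkExpansion_covShiftAv_oneScaleTorus)

variable {N : ℕ}

open Summit.QuantumFields.BalabanUV.Gaps.D4WalkBlockTransportAlgebra
  (conjOp rowSumNorm colSumNorm colSumNorm_nonneg rowMass_defect_le_of_letters rowMass_defect_pair_le)
open Summit.QuantumFields.BalabanUV.Gaps.D4WalkBlockShiftTransport (differentiableOn_defect')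

/-! ## §4. Cor. 3.5's step for the covariant Laplacian in a TRANSPORTER background with the two (3.37)-type letters -/

section Transport

variable {d L : ℕ} {a msq : ℝ}
variable {dd N' : ℕ} {E : Type*} [NormedAddCommGroup E] [NormedSpace ℂ E]

/-- row mass of a finite sum of fibre matrices. -/
theorem rowMass_sum_le {ι : Type*} (s : Finset ι) (A : ι → Matrix (Fin N × Fin N) (Fin N × Fin N) ℂ) (p : Fin N × Fin N) :
    ∑ q, ‖(∑ i ∈ s, A i) p q‖ ≤ ∑ i ∈ s, ∑ q, ‖A i p q‖ := by
  calc ∑ q, ‖(∑ i ∈ s, A i) p q‖ = ∑ q, ‖∑ i ∈ s, A i p q‖ := Finset.sum_congr rfl fun q _ => by rw [Matrix.sum_apply]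
    _ ≤ ∑ q, ∑ i ∈ s, ‖A i p q‖ := Finset.sum_le_sum fun q _ => norm_sum_le _ _
    _ = ∑ i ∈ s, ∑ q, ‖A i p q‖ := Finset.sum_comm

/-- **[B9] COR. 3.5's STEP FOR THE COVARIANT LAPLACIAN IN A TRANSPORTER BACKGROUND, FROM THE TWO (3.37)-TYPE LETTERS.**  There are
`δ₀, C > 0` (B6's) such that for every member `i` of the one-scale torus family, every `N`, every holomorphic family of forward bond
transporters `U⁺_μ(u, x) ∈ Matrix (Fin N) (Fin N) ℂ` with inverses `U⁻_μ(u, x)` (`U⁺U⁻ = 1`) on a ball, satisfying the BOND letter (row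
and column sums of `U⁺ − 1`, `U⁻ − 1` at most `ηα₀`) and the DERIVATIVE letter (row and column sums of `U⁺_μ(u, x) − U⁺_μ(u, x − e_μ)` at
most `η²α₁`) — print's (3.37) `|A| < α₁(Lʲη)⁻¹`, `|∇A| < α₁(Lʲη)⁻²` for `U′ = e^{iηA}` —, every holomorphic CUBE-LOCAL averaging
correction `V_av(u)` with row sums at most `α_av` (`D4WalkBlockCovariantAveraging`), every cube row sum `(μ, c_μ)`, rates `0 ≤ μ`,
`2μ ≤ ε`, `2μ ≤ ½δ₀ − ε − μ` and the MARGIN with `α = 2α₀ + α₀²`, `α′ = d(2α₁ + 4α₀²) + α_av`: with the defects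
`W⁺_μ(x) = conjOp U⁺U⁻ − 1`, `W⁻_μ(x) = conjOp U⁻(x − e_μ)U⁺(x − e_μ) − 1`, `(G′ ⊗ 1)(1 − (V_W(u) + V_av(u))(G′ ⊗ 1))⁻¹` is a block walk
expansion with derivative letters — constants uniform in `K` and the volume, explicit in `(α₀, α₁, α_av, d, N)`. [cite: Balaban1985BackgroundPropagators, (3.37) p.396, (3.50)–(3.54) pp.400–401, (3.60)–(3.64) p.402, Cor. 3.5 p.407; Balaban1984PropagatorsII, Prop. 2.2 (2.67) p.234] -/
theorem blockWalkExpansion_transport_oneScaleTorus (hd : 1 ≤ d) (hL : Odd L ∧ 1 < L) (ha : 0 < a) (hmsq : 0 ≤ msq) :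
    ∃ δ₀ C : ℝ, 0 < δ₀ ∧ 0 < C ∧ ∀ (i : Index d L) (N : ℕ) (c₀ : B13.Consts) (X : Finset (UT (Nv i.P i.P.K))) (R : ℝ)
      (Up Upi : Fin i.P.d → E → Site i.P 0 → Matrix (Fin N) (Fin N) ℂ)
      (Vav : E → Matrix (Site i.P 0 × (Fin N × Fin N)) (Site i.P 0 × (Fin N × Fin N)) ℂ) (α₀ α₁ αav ε μ cμ : ℝ),
      (∀ ν x a' c, DifferentiableOn ℂ (fun u => Up ν u x a' c) (ball (0 : E) R)) →
      (∀ ν x a' c, DifferentiableOn ℂ (fun u => Upi ν u x a' c) (ball (0 : E) R)) →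
      (∀ p q, DifferentiableOn ℂ (fun u => Vav u p q) (ball (0 : E) R)) →
      (∀ ν u x, Up ν u x * Upi ν u x = 1) → 0 ≤ α₀ → 0 ≤ α₁ → 0 ≤ αav →
      (∀ ν, ∀ u ∈ ball (0 : E) R, ∀ x a', rowSumNorm (Up ν u x - 1) a' ≤ i.P.eps * α₀ ∧ colSumNorm (Up ν u x - 1) a' ≤ i.P.eps * α₀ ∧
        rowSumNorm (Upi ν u x - 1) a' ≤ i.P.eps * α₀ ∧ colSumNorm (Upi ν u x - 1) a' ≤ i.P.eps * α₀) →
      (∀ ν, ∀ u ∈ ball (0 : E) R, ∀ x a', rowSumNorm (Up ν u x - Up ν u (Site.unshift x ν)) a' ≤ i.P.eps ^ 2 * α₁ ∧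
        colSumNorm (Up ν u x - Up ν u (Site.unshift x ν)) a' ≤ i.P.eps ^ 2 * α₁) →
      (∀ u p q, Vav u p q ≠ 0 → cubeOf i.P p.1 = cubeOf i.P q.1) →
      (∀ u ∈ ball (0 : E) R, ∀ p, ∑ q, ‖Vav u p q‖ ≤ αav) →
      0 ≤ μ → 2 * μ ≤ ε → 2 * μ ≤ δ₀ / 2 - ε - μ → 0 ≤ cμ →
      RowSum (toB6 (torusGeom (Nv i.P i.P.K) 0 0 0) 0 True) μ cμ →
      cμ * (cμ * 1 * (1 * (((i.P.d : ℝ) * (2 * α₁ + 4 * α₀ ^ 2) + αav +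
        ∑ ι, (2 * α₀ + α₀ ^ 2) * covB i.P δ₀ ι) * C)) * cμ) * cμ < 1 →
      ∃ (W : Type) (T : W → (TPt dd N' → ℂ) → E → Matrix (Site i.P 0 × (Fin N × Fin N)) (Site i.P 0 × (Fin N × Fin N)) ℂ)
        (SX' : Set W) (A' : W → ℝ) (D' : W → UT (Nv i.P i.P.K) → UT (Nv i.P i.P.K) → ℝ),
        BlockWalkExpansion c₀ (fun q : Site i.P 0 × (Fin N × Fin N) => cubeOf i.P q.1) (fun q => cubeOf i.P q.1)
          (fun (_ : TPt dd N' → ℂ) u =>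
            Matrix.blockDiagonal (fun _ : Fin N × Fin N => ((tower i.P a msq).G i.P.K).map ((↑) : ℝ → ℂ)) *
              (1 - (covShift i.P (Fin N × Fin N) (fun ν u x => conjOp (Up ν u x) (Upi ν u x) - 1)
                  (fun ν u x => conjOp (Upi ν u (Site.unshift x ν)) (Up ν u (Site.unshift x ν)) - 1) u + Vav u) *
                Matrix.blockDiagonal (fun _ : Fin N × Fin N => ((tower i.P a msq).G i.P.K).map ((↑) : ℝ → ℂ)))⁻¹) X R
          (ε - 2 * μ) (δ₀ / 2 - ε - μ - 2 * μ)
          (cμ * C * (1 * (1 - cμ * (cμ * 1 * (1 * (((i.P.d : ℝ) * (2 * α₁ + 4 * α₀ ^ 2) + αav +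
            ∑ ι, (2 * α₀ + α₀ ^ 2) * covB i.P δ₀ ι) * C)) * cμ) * cμ)⁻¹) * cμ)
          T SX' A' D' (δ₀ / 2 - 2 * μ) ∧
        (∀ (ι : Fin i.P.d ⊕ Fin i.P.d) ω (σ : TPt dd N' → ℂ), (∀ j, ‖σ j‖ ≤ Real.exp c₀.κ₁) → ∀ u ∈ ball (0 : E) R, ∀ Y Y',
          blockNorm (fun q : Site i.P 0 × (Fin N × Fin N) => cubeOf i.P q.1) (fun q => cubeOf i.P q.1)
              (covDop i.P (Fin N × Fin N) ι * T ω σ u) Y Y' ≤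
            covB i.P δ₀ ι * (A' ω * Real.exp (-((δ₀ / 2 - 2 * μ) * D' ω Y Y')))) ∧
        ∀ ω, DomBy (toB6 (torusGeom (Nv i.P i.P.K) 0 0 0) 0 True) (D' ω) := by
  obtain ⟨δ₀, C, hδ₀, hC, h⟩ := blockWalkExpansion_covShiftAv_oneScaleTorus (dd := dd) (N' := N') (E := E) hd hL ha hmsq
  refine ⟨δ₀, C, hδ₀, hC, fun i N c₀ X R Up Upi Vav α₀ α₁ αav ε μ cμ hUp hUpi hVavh hinv hα₀ hα₁ hαav hbond hder hloc hav hμ hμε hμκ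
    hcμ hrow hq => ?_⟩
  have hε : 0 < i.P.eps := by unfold Params.eps; exact pow_pos (inv_pos.2 i.P.cast_L_pos) _
  have hε1 : i.P.eps ≤ 1 := by
    unfold Params.eps
    exact pow_le_one₀ (inv_nonneg.2 i.P.cast_L_pos.le) (inv_le_one_of_one_le₀ (by exact_mod_cast i.P.hL.2.le))
  have hinv' : ∀ ν u x, Upi ν u x * Up ν u x = 1 := fun ν u x => mul_eq_one_comm.1 (hinv ν u x)
  refine h i (Fin N × Fin N) c₀ X R _ _ Vav (2 * α₀ + α₀ ^ 2) ((i.P.d : ℝ) * (2 * α₁ + 4 * α₀ ^ 2)) αav ε μ cμ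
    (fun ν x p q => differentiableOn_defect' (fun a c => hUp ν x a c) (fun a c => hUpi ν x a c) p q)
    (fun ν x p q => differentiableOn_defect' (fun a c => hUpi ν _ a c) (fun a c => hUp ν _ a c) p q) hVavh
    (by positivity) (by positivity) hαav (fun ν u hu x p => ?_) (fun ν u hu x p => ?_) (fun u hu x p => ?_) hloc hav
    hμ hμε hμκ hcμ hrow hq
  · -- bond window, forward defect
    obtain ⟨a', b⟩ := p
    have hδ : 0 ≤ i.P.eps * α₀ := by positivity
    calc ∑ q, ‖(conjOp (Up ν u x) (Upi ν u x) - 1) (a', b) q‖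
        ≤ i.P.eps * α₀ * (1 + i.P.eps * α₀) + i.P.eps * α₀ :=
          rowMass_defect_le_of_letters _ _ hδ (fun a => (hbond ν u hu x a).1) (fun b => (hbond ν u hu x b).2.2.2) a' b
      _ ≤ i.P.eps * (2 * α₀ + α₀ ^ 2) := by nlinarith [mul_nonneg hε.le hα₀, mul_le_of_le_one_left (mul_nonneg hε.le hα₀) hε1]
  · -- bond window, backward defect (transporter of the preceding bond)
    obtain ⟨a', b⟩ := p
    have hδ : 0 ≤ i.P.eps * α₀ := by positivity
    calc ∑ q, ‖(conjOp (Upi ν u (Site.unshift x ν)) (Up ν u (Site.unshift x ν)) - 1) (a', b) q‖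
        ≤ i.P.eps * α₀ * (1 + i.P.eps * α₀) + i.P.eps * α₀ :=
          rowMass_defect_le_of_letters _ _ hδ (fun a => (hbond ν u hu _ a).2.2.1) (fun b => (hbond ν u hu _ b).2.1) a' b
      _ ≤ i.P.eps * (2 * α₀ + α₀ ^ 2) := by nlinarith [mul_nonneg hε.le hα₀, mul_le_of_le_one_left (mul_nonneg hε.le hα₀) hε1]
  · -- divergence window: sum over the axes of the defect pairs
    obtain ⟨a', b⟩ := p
    have hδ : 0 ≤ i.P.eps * α₀ := by positivity
    have hpair : ∀ ν, ∑ q, ‖((conjOp (Up ν u x) (Upi ν u x) - 1) +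
        (conjOp (Upi ν u (Site.unshift x ν)) (Up ν u (Site.unshift x ν)) - 1)) (a', b) q‖ ≤
        2 * (i.P.eps ^ 2 * α₁) + 4 * (i.P.eps * α₀) ^ 2 := fun ν =>
      rowMass_defect_pair_le _ _ _ _ (hinv ν u x) (hinv' ν u _) hδ (fun a => (hbond ν u hu x a).1)
        (fun b => (hbond ν u hu x b).2.1) (fun b => (hbond ν u hu x b).2.2.2) (fun a => (hbond ν u hu _ a).1)
        (fun b => (hbond ν u hu _ b).2.1) (fun a => (hbond ν u hu _ a).2.2.1) (fun a => (hder ν u hu x a).1)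
        (fun b => (hder ν u hu x b).2) a' b
    calc ∑ q, ‖(∑ ν, ((conjOp (Up ν u x) (Upi ν u x) - 1) +
          (conjOp (Upi ν u (Site.unshift x ν)) (Up ν u (Site.unshift x ν)) - 1))) (a', b) q‖
        ≤ ∑ ν, ∑ q, ‖((conjOp (Up ν u x) (Upi ν u x) - 1) +
          (conjOp (Upi ν u (Site.unshift x ν)) (Up ν u (Site.unshift x ν)) - 1)) (a', b) q‖ := rowMass_sum_le _ _ _
      _ ≤ ∑ _ν : Fin i.P.d, (2 * (i.P.eps ^ 2 * α₁) + 4 * (i.P.eps * α₀) ^ 2) := Finset.sum_le_sum fun ν _ => hpair ν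
      _ = i.P.eps ^ 2 * ((i.P.d : ℝ) * (2 * α₁ + 4 * α₀ ^ 2)) := by
          rw [Finset.sum_const, Finset.card_univ, Fintype.card_fin, nsmul_eq_mul]; ring

end Transport

end Summit.QuantumFields.BalabanUV.Gaps.D4WalkBlockTransportWindows

end
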